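import Summits.Ventures.Crystal3D.Bulk.LocalTwelve
import Summits.Ventures.Crystal3D.StickySpheres.RadiusOne
import Literature.Geometry.DiscreteGeometry.TameContactGraphs
import HarnessLib

/-!
# `L12Local` from Hales 2012: the local twelve-neighbour lemma follows from `flyspeck_L12` and the
# classification of kissing configurations

HONEST FRAMING. Part of the venture `Summits/Ventures/Crystal3D` (cell `pub-crystal3d`, phase 2),
companion of `Bulk/LocalTwelve.lean`. This file makes the cell's referee-2 READING of the proof of
Hales 2012, Theorem 1 ("the global kissing-number-twelve hypothesis is used only through Lemma 2
at the centre and at its twelve neighbours") a KERNEL THEOREM relative to the tree's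
formalisation of that proof (`Literature/Geometry/DiscreteGeometry/FejesTothKissingTwelve.lean`
and its companions):

* `l12Local_of_hales : flyspeck_L12 → Hales2012_kissingConfigCongruent → L12Local`, hence
* `bulkCrystallization3D_of_hales : flyspeck_L12 → Hales2012_kissingConfigCongruent →
  BulkCrystallization3D 1296`, and the same from `Hales2012_contactGraphTame` (Theorem 3 with
  Lemma 8, graph form) through the tree's PROVED Lemmas 9–10
  (`kissingConfigCongruent_of_contactGraphTame`).

TRUST BASE, exactly. `flyspeck_L12` (Hales 2012, Lemma 1 = the local annulus inequality of
*Dense Sphere Packings*, computer-assisted, formally verified in HOL Light/Isabelle 2014) is a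
NAMED FACT of the tree. `Hales2012_kissingConfigCongruent` (every `V ∈ 𝒱` is congruent to the
FCC or HCP configuration) is a named fact that the tree DISCHARGES computationally
(`Hales2012_kissingConfigCongruent_holds`, `KissingSearchFinal.lean`, a verified growth search run
by `native_decide`, axiom `Lean.ofReduceBool`); this file keeps it as a HYPOTHESIS so that every
theorem here has the standard axioms only — instantiate with the `_holds` theorem to obtain
`flyspeck_L12 → BulkCrystallization3D 1296` modulo `Lean.ofReduceBool`. NO unconditional
crystallization theorem is claimed.

## The argument (Hales 2012, pp. 2 and 14, read locally)

Let `x` be a finite packing of unit-diameter balls, `V = {2 xⱼ}` the doubled centre set (a packing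
of unit balls in Hales's sense), `u = 2 xᵢ`. (1) If ball `i` has twelve contacts, `L12` applied to
the twelve touching centres and any thirteenth centre within `2h₀ = 2.52` of `u` gives
`12 + L(·) ≤ 12`, so every other centre is at distance `2` or `≥ 2h₀` from `u` (Lemma 2 AT
`u`;
the tree proves the global Lemma 2 by the same five lines, `hales2012_separation_of_L12`).
(2) If moreover every contact neighbour of `i` has twelve contacts, (1) at each neighbour shows
that the shell `kissingShell V u` (= `contactShell x i`) belongs to Hales's class `𝒱`
(`IsKissingConfig`: twelve points of `S²(2)` pairwise at distance `2` or `≥ 2h₀`). (3) The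
classification `Hales2012_kissingConfigCongruent` then says the shell is arranged in the FCC or the
HCP pattern, i.e. `IsClosePackedShell x i`.

## Sources

T. C. Hales, arXiv:1209.6043 (2012): Lemma 1 (`L12`), Lemma 2, Definition 1, Theorem 3,
Lemmas 9–10, proof of Theorem 1 (p. 14) — all as vendored/proved in the tree files cited above.
-/

noncomputable section

open scoped BigOperators
open Finset

namespace Summit.Ventures.Crystal3D

open Literature.Geometry.DiscreteGeometry

variable {N : ℕ} {x : Fin N → EuclideanSpace ℝ (Fin 3)}

/-! ## The doubled packing and its kissing shells -/

/-! The doubled centre set `Set.range fun j => 2 • x j` is Hales's normalisation (unit RADIUS,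
touching centres at distance `2`) — the same rendering as the venture's radius-one bridge
`StickySpheres/RadiusOne.lean` (`isUnitPacking_iff_two_smul`, `dist_two_smul`). -/

/-- The doubled centre set of a packing of unit-diameter balls is a packing of unit balls in
Hales's sense (`IsUnitBallPacking`: centres closer than `2` coincide). -/
theorem isUnitBallPacking_range_two_smul (hx : IsUnitPacking x) :
    IsUnitBallPacking (Set.range fun j => (2 : ℝ) • x j) :=
  ((isUnitPacking_iff_two_smul x).1 hx).2

/-- The kissing shell (tree: `kissingShell`, Hales's Definition 1) of `2 xᵢ` in the doubled set is
the contact shell of ball `i`. -/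
theorem kissingShell_range_two_smul (i : Fin N) :
    kissingShell (Set.range fun j => (2 : ℝ) • x j) ((2 : ℝ) • x i) = contactShell x i := by
  ext v
  rw [mem_kissingShell_iff, mem_contactShell]
  constructor
  · rintro ⟨⟨j, hj⟩, hv⟩
    have hj : (2 : ℝ) • x j = (2 : ℝ) • x i + v := hj
    have hv' : v = (2 : ℝ) • (x j - x i) := by
      rw [smul_sub, hj]; abel
    refine ⟨j, (mem_contactNeighbors x).2 ⟨?_, ?_⟩, hv'.symm⟩
    · rintro rfl
      rw [sub_self, smul_zero] at hv'
      rw [hv', norm_zero] at hv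
      norm_num at hv
    · rw [hv', norm_smul, Real.norm_of_nonneg zero_le_two, ← dist_eq_norm, dist_comm] at hv
      linarith
  · rintro ⟨j, hj, rfl⟩
    refine ⟨⟨j, by rw [smul_sub]; abel⟩, ?_⟩
    rw [norm_smul, Real.norm_of_nonneg zero_le_two, ← dist_eq_norm, dist_comm,
      ((mem_contactNeighbors x).1 hj).2, mul_one]

/-- Hence, in a packing, the kissing shell of `2 xᵢ` has `coordination x i` points. -/
theorem ncard_kissingShell_range_two_smul (hx : IsUnitPacking x) (i : Fin N) :
    (kissingShell (Set.range fun j => (2 : ℝ) • x j) ((2 : ℝ) • x i)).ncard =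
      coordination x i := by
  rw [kissingShell_range_two_smul, ncard_contactShell hx]

/-- A point of the doubled set touching `2 xᵢ` is `2 xⱼ` for a contact neighbour `j` of `i`. -/
theorem exists_eq_two_smul_of_dist_eq_two {i : Fin N} {w : EuclideanSpace ℝ (Fin 3)}
    (hw : w ∈ Set.range fun j => (2 : ℝ) • x j) (hd : dist w ((2 : ℝ) • x i) = 2) :
    ∃ j ∈ contactNeighbors x i, w = (2 : ℝ) • x j := by
  obtain ⟨j, rfl⟩ := hw
  refine ⟨j, (mem_contactNeighbors x).2 ⟨?_, ?_⟩, rfl⟩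
  · rintro rfl
    rw [dist_self] at hd
    norm_num at hd
  · have hd' : dist ((2 : ℝ) • x j) ((2 : ℝ) • x i) = 2 := hd
    rw [dist_two_smul, dist_comm] at hd'
    linarith

/-! ## Lemma 2 of Hales 2012, at ONE twelve-coordinated point -/

/-- **Hales 2012, Lemma 2, LOCAL form** (from Lemma 1 = `flyspeck_L12`, by the printed five-line
argument): in a packing of unit balls, if `u ∈ V` has twelve points of `V` at distance `2`, then
every `v ∈ V` is `u`, at distance `2` from `u`, or at distance `≥ 2h₀ = 2.52` from `u`. Only
the
twelve neighbours OF `u` are used (the tree's `hales2012_separation_of_L12` is the same proof under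
the global kissing-number-twelve hypothesis). -/
theorem separation_of_twelve_of_L12 (hL12 : flyspeck_L12) {V : Set (EuclideanSpace ℝ (Fin 3))}
    (hV : IsUnitBallPacking V) {u : EuclideanSpace ℝ (Fin 3)} (hu : u ∈ V)
    (h12 : (kissingShell V u).ncard = 12) :
    ∀ v ∈ V, u = v ∨ dist u v = 2 ∨ 2 * hales_h0 ≤ dist u v := by
  intro v hv
  by_cases huv : u = v
  · exact Or.inl huv
  by_cases h2 : dist u v = 2
  · exact Or.inr (Or.inl h2)
  refine Or.inr (Or.inr ?_)
  by_contra hlt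
  push Not at hlt
  have hge : 2 ≤ dist u v := hV.two_le_dist hu hv huv
  -- the twelve kissing points around `u`, recentred
  have hfin : (kissingShell V u).Finite := Set.finite_of_ncard_ne_zero (by rw [h12]; norm_num)
  set F : Finset (EuclideanSpace ℝ (Fin 3)) := hfin.toFinset with hF
  have hFcard : F.card = 12 := by
    rw [hF, ← Set.ncard_eq_toFinset_card _ hfin]; exact h12
  have hmemF : ∀ y, y ∈ F ↔ u + y ∈ V ∧ ‖y‖ = 2 := fun y => by
    rw [hF, Set.Finite.mem_toFinset]; rfl
  -- the thirteenth point
  set z : EuclideanSpace ℝ (Fin 3) := v - u with hz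
  have hznorm : ‖z‖ = dist u v := by rw [hz, ← dist_eq_norm, dist_comm]
  have hzF : z ∉ F := fun h => h2 (by rw [← hznorm]; exact ((hmemF z).1 h).2)
  have hmemW : ∀ y ∈ insert z F, u + y ∈ V := by
    intro y hy
    rcases Finset.mem_insert.1 hy with rfl | hy
    · simpa [hz] using hv
    · exact ((hmemF y).1 hy).1
  have hsum := hL12 (insert z F) ?_ ?_
  · rw [Finset.sum_insert hzF] at hsum
    have hsum12 : ∑ y ∈ F, halesL (‖y‖ / 2) = 12 := by
      rw [Finset.sum_congr rfl fun y hy => by rw [((hmemF y).1 hy).2]]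
      norm_num [halesL_one, hFcard]
    rw [hsum12] at hsum
    have hL0 : halesL (‖z‖ / 2) ≤ 0 := by linarith
    have := hales_h0_le_of_halesL_nonpos hL0
    rw [hznorm] at this
    linarith
  · -- pairwise distances `≥ 2`: translates of distinct points of the packing
    intro p hp q hq hpq
    have h := hV.two_le_dist (hmemW p hp) (hmemW q hq) (by simpa using hpq)
    simpa using h
  · -- all in the annulus `2 ≤ ‖·‖ ≤ 2h₀`
    intro y hy
    rcases Finset.mem_insert.1 hy with rfl | hy
    · exact ⟨hznorm ▸ hge, hznorm ▸ hlt.le⟩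
    · rw [((hmemF y).1 hy).2, hales_h0_eq]
      norm_num

/-- **The shell of a twelve-coordinated point all of whose neighbours are twelve-coordinated is a
kissing configuration** (`∈ 𝒱`, tree `IsKissingConfig`): Lemma 2 applied AT EACH NEIGHBOUR
gives
the separation `2` or `≥ 2h₀` between any two shell points. -/
theorem isKissingConfig_kissingShell_of_twelve (hL12 : flyspeck_L12)
    {V : Set (EuclideanSpace ℝ (Fin 3))} (hV : IsUnitBallPacking V)
    {u : EuclideanSpace ℝ (Fin 3)} (h12 : (kissingShell V u).ncard = 12)
    (hnb : ∀ w ∈ V, dist w u = 2 → (kissingShell V w).ncard = 12) :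
    IsKissingConfig (kissingShell V u) := by
  refine ⟨h12, fun y hy => hy.2, fun y hy y' hy' => ?_⟩
  -- `u + y` is a neighbour of `u`, hence twelve-coordinated; separate `u + y'` from it
  have hyn : (kissingShell V (u + y)).ncard = 12 :=
    hnb (u + y) hy.1 (by rw [dist_eq_norm, add_sub_cancel_left, hy.2])
  have h := separation_of_twelve_of_L12 hL12 hV hy.1 hyn (u + y') hy'.1
  rw [dist_add_left] at h
  rcases h with h | h
  · exact Or.inl (add_left_cancel h)
  · exact Or.inr h

/-! ## `L12Local` and bulk crystallization from the named facts -/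

/-- **`L12(1)` from Hales 2012**: `flyspeck_L12` (Lemma 1) and the classification of kissing
configurations (`Hales2012_kissingConfigCongruent`, Lemmas 9–10 with Theorem 3) imply the local
twelve-neighbour lemma `L12Local` of `Bulk/LocalTwelve.lean`. -/
theorem l12Local_of_hales (hL12 : flyspeck_L12) (hcl : Hales2012_kissingConfigCongruent) :
    L12Local := by
  intro N x hx i h12 hnb
  have hV := isUnitBallPacking_range_two_smul hx
  have h12' :
      (kissingShell (Set.range fun j => (2 : ℝ) • x j) ((2 : ℝ) • x i)).ncard = 12 := by
    rw [ncard_kissingShell_range_two_smul hx, h12]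
  have hnb' : ∀ w ∈ Set.range (fun j => (2 : ℝ) • x j), dist w ((2 : ℝ) • x i) = 2 →
      (kissingShell (Set.range fun j => (2 : ℝ) • x j) w).ncard = 12 := by
    intro w hw hd
    obtain ⟨j, hj, rfl⟩ := exists_eq_two_smul_of_dist_eq_two hw hd
    rw [ncard_kissingShell_range_two_smul hx, hnb j hj]
  have hK := isKissingConfig_kissingShell_of_twelve hL12 hV h12' hnb'
  rw [kissingShell_range_two_smul] at hK
  exact hcl _ hK

/-- **Bulk crystallization from Hales 2012's inputs**: `flyspeck_L12` and
`Hales2012_kissingConfigCongruent` give `BulkCrystallization3D 1296` (standard axioms; both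
hypotheses are named facts of the tree, the second discharged computationally there). -/
theorem bulkCrystallization3D_of_hales (hL12 : flyspeck_L12)
    (hcl : Hales2012_kissingConfigCongruent) : BulkCrystallization3D 1296 :=
  bulkCrystallization3D_of_L12Local (l12Local_of_hales hL12 hcl)

/-- The same from the two COMPUTER-ASSISTED named facts of Hales's paper as vendored in the tree:
`flyspeck_L12` (Lemma 1) and `Hales2012_contactGraphTame` (Theorem 3 with Lemma 8, graph form),
Lemmas 9 and 10 being PROVED in the tree (`kissingConfigCongruent_of_contactGraphTame`). -/
theorem bulkCrystallization3D_of_L12_of_contactGraphTame (hL12 : flyspeck_L12)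
    (h8 : Hales2012_contactGraphTame) : BulkCrystallization3D 1296 :=
  bulkCrystallization3D_of_hales hL12 (kissingConfigCongruent_of_contactGraphTame h8)

end Summit.Ventures.Crystal3D

end
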